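import Summits.ResolutionOfSingularities.ResolutionOfSingularities.Theorems.PurelyInseparableDim4SpineCertCycles
import HarnessLib
import HarnessLib.Audit.Tags

/-!
# Purely inseparable fourfolds — cardinality-first SPINE CYCLES at ODD exponents `q = 3, 5` (N-CF beyond `p = 2`)

Census cell «res-dim4-pi» (D-0157 DOOR 2), seat res-dim4-p-8 (W3-3 follow-up).  [OURS · counted 0 · AI kernel
work, weaker than expert review.]  Nothing here is about resolution of singularities itself; nothing here
proves resolution in dimension ≥ 4 / characteristic `p`.

Every cycle certified so far (`SpineCertBatch*`, 460 classes) lives at `q = 2`.  The spine-cycle phenomenon of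
the cardinality-first rule (the support shadow of the cell's MODE 1h, ties free) is NOT special to `p = 2`: a
small local search of Hironaka's pure game at `q = 3` and `q = 5` (this seat, `HOME/res-dim4-p-8/qlit.py`;
two-monomial positions, exponents ≤ 4 resp. ≤ 6) finds literal cardinality-first cycles at once — already with
TWO monomials and period 2.  Three of each are certified here (`decide` on `SpineCert.cycleCertB`), and the
generic machinery of `SpineCertCycles` turns each into a CARDINALITY-FIRST POSITIONAL STRATEGY WITH AN INFINITE
PURE PLAY: N-CF (∃-over-ties form) at `q = 3` and at `q = 5` (`exists_cardFirst_strategy_not_purePositionalWin_three`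
/ `_five`).  Not claimed: anything about the engines' `p = 3, 5` sweeps (S-2a / S-3), whose states these need not be;
nor that every tie-breaking loses (the cycles run through ties).

[cite: Spivakovsky1983, §1 (Hironaka's polyhedra game)]; cycles OURS.
bears_on: LADDER-RESOLUTION:D157-DOOR2 (res-dim4-pi · W3-3 · N-CF). Supports stmt-ResolutionOfSingularities-16155 (helper).
-/

-- cell convention (DR-157-C): the summit's doubled path segment is intended, as in the landed Target file
set_option linter.dupNamespace false

namespace Summit.ResolutionOfSingularities.ResolutionOfSingularities.Theorems.PIDim4.SpineCert

/-! ## 1. `q = 3` -/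

/-- Three literal cardinality-first cycles of Hironaka's pure game at `q = 3` in four variables (two monomials
each; variables `x₁..x₄` = indices `0..3`). [folklore] -/
def batchQ3 : List (List (Finset (Fin 4 → ℕ) × Finset (Fin 4) × Fin 4)) := [
  -- {(0, 0, 2, 2), (1, 2, 0, 2)} —({x₁,x₃,x₄}, x₁)→ …, period 2
  [({![0, 0, 2, 2], ![1, 2, 0, 2]}, {0, 2, 3}, 0), ({![0, 2, 0, 2], ![1, 0, 2, 2]}, {0, 1, 3}, 0)],
  -- {(0, 2, 4, 0), (1, 2, 0, 2)} —({x₁,x₃,x₄}, x₁)→ …, period 2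
  [({![0, 2, 4, 0], ![1, 2, 0, 2]}, {0, 2, 3}, 0), ({![0, 2, 0, 2], ![1, 2, 4, 0]}, {0, 1, 3}, 0)],
  -- {(1, 1, 4, 0), (1, 2, 0, 2)} —({x₁,x₂,x₃}, x₁)→ …, period 2
  [({![1, 1, 4, 0], ![1, 2, 0, 2]}, {0, 1, 2}, 0), ({![0, 2, 0, 2], ![3, 1, 4, 0]}, {0, 1, 3}, 0)]]

/-- Kernel evaluation of the cycle checker at `q = 3`. [OURS · ‖ K] [folklore] -/
theorem cycleCertB_batchQ3 : batchQ3.all (cycleCertB 3) = true := by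
  decide

/-- **Every entry of `batchQ3` is a literal cardinality-first cycle at `q = 3`.** [OURS · ‖ K] [folklore] -/
theorem cycleCert_batchQ3 : ∀ c ∈ batchQ3, CycleCert 3 c :=
  cycleCert_of_all_cycleCertB 3 _ cycleCertB_batchQ3

/-- The first `q = 3` certificate, by name. [OURS · ‖ K] [folklore] -/
theorem cycleCert_q3 : CycleCert 3 (batchQ3.get ⟨0, by decide⟩) :=
  cycleCert_batchQ3 _ (List.get_mem _ _)

/-- **N-CF at `q = 3` (∃-over-ties form).**  In Hironaka's pure polyhedra game in four variables at threshold
`q = 3` there is a cardinality-first positional strategy (a permissible centre of least cardinality at every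
not-yet-won position) with an infinite play; it is not a positional win. [OURS · ‖ K] [folklore] -/
theorem exists_cardFirst_strategy_not_purePositionalWin_three :
    ∃ σ : SpineStrategy,
      (∀ A : SpinePos, ¬ SpineWon 3 A →
          SpinePermissible 3 (σ A) A ∧ ∀ J, SpinePermissible 3 J A → (σ A).card ≤ J.card) ∧
        (∃ A : ℕ → SpinePos, IsPurePlay 3 σ A) ∧ ¬ IsPurePositionalWin 3 σ :=
  ⟨cycleCert_q3.strategy, cycleCert_q3.strategy_cardFirst, ⟨_, cycleCert_q3.isPurePlay⟩,
    cycleCert_q3.not_isPurePositionalWin⟩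

/-! ## 2. `q = 5` -/

/-- Three literal cardinality-first cycles of Hironaka's pure game at `q = 5` in four variables (two monomials
each). [folklore] -/
def batchQ5 : List (List (Finset (Fin 4 → ℕ) × Finset (Fin 4) × Fin 4)) := [
  -- {(0, 3, 5, 1), (1, 2, 0, 4)} —({x₁,x₃,x₄}, x₁)→ …, period 2
  [({![0, 3, 5, 1], ![1, 2, 0, 4]}, {0, 2, 3}, 0), ({![0, 2, 0, 4], ![1, 3, 5, 1]}, {0, 1, 3}, 0)],
  -- {(0, 2, 5, 1), (2, 3, 0, 4)} —({x₁,x₂,x₃}, x₁)→ …, period 2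
  [({![0, 2, 5, 1], ![2, 3, 0, 4]}, {0, 1, 2}, 0), ({![0, 3, 0, 4], ![2, 2, 5, 1]}, {0, 1, 3}, 0)],
  -- {(1, 2, 0, 4), (1, 3, 5, 1)} —({x₁,x₂,x₄}, x₁)→ …, period 2
  [({![1, 2, 0, 4], ![1, 3, 5, 1]}, {0, 1, 3}, 0), ({![0, 3, 5, 1], ![2, 2, 0, 4]}, {0, 2, 3}, 0)]]

/-- Kernel evaluation of the cycle checker at `q = 5`. [OURS · ‖ K] [folklore] -/
theorem cycleCertB_batchQ5 : batchQ5.all (cycleCertB 5) = true := by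
  decide

/-- **Every entry of `batchQ5` is a literal cardinality-first cycle at `q = 5`.** [OURS · ‖ K] [folklore] -/
theorem cycleCert_batchQ5 : ∀ c ∈ batchQ5, CycleCert 5 c :=
  cycleCert_of_all_cycleCertB 5 _ cycleCertB_batchQ5

/-- The first `q = 5` certificate, by name. [OURS · ‖ K] [folklore] -/
theorem cycleCert_q5 : CycleCert 5 (batchQ5.get ⟨0, by decide⟩) :=
  cycleCert_batchQ5 _ (List.get_mem _ _)

/-- **N-CF at `q = 5` (∃-over-ties form).** [OURS · ‖ K] [folklore] -/
theorem exists_cardFirst_strategy_not_purePositionalWin_five :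
    ∃ σ : SpineStrategy,
      (∀ A : SpinePos, ¬ SpineWon 5 A →
          SpinePermissible 5 (σ A) A ∧ ∀ J, SpinePermissible 5 J A → (σ A).card ≤ J.card) ∧
        (∃ A : ℕ → SpinePos, IsPurePlay 5 σ A) ∧ ¬ IsPurePositionalWin 5 σ :=
  ⟨cycleCert_q5.strategy, cycleCert_q5.strategy_cardFirst, ⟨_, cycleCert_q5.isPurePlay⟩,
    cycleCert_q5.not_isPurePositionalWin⟩

end Summit.ResolutionOfSingularities.ResolutionOfSingularities.Theorems.PIDim4.SpineCert
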